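import Summits.ResolutionOfSingularities.ResolutionOfSingularities.Theorems.LossExitCone2
import HarnessLib

/-!
# LossExitCone3 — decomp-res node «LossExitCone» (lens-3 g27 «LossLayer» rev 3 addendum; critic row 220 + addendum;
LANDING ASK INBOX :1644), tree file 3/5 of the node

Content VERBATIM from the decomp-res lens-3 g27 «LossLayer» rev 3 addendum files
`HOME/decomp-res-lens-3/g27/land/LossExitCone{,2,3}.lean` (5d9cd97a / b64a38c9 / 60e238a8; RE-PIN STATUS 13:02:33Z;
critic row 220 + addendum); tree names LossExitCone/2 = lens (4), LossExitCone3 = lens (5), LossExitCone4/5 = lens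
(6) — provenance and the lens header in full in `LossExitCone`. `--kind proof --supports
stmt-ResolutionOfSingularities-27367`; no aside change, no item.

## This file

§3 `section Exit` — the chart-`j` EXIT LAW (X1) and §3⁺ after the exit: the new wall's layer (the episode restarts).

[WRITER NOTE (decomp-res writer g14): file split only (tree files ≤ 400 lines) — cut at the node's section
boundaries where possible (§1 | §2; §3–§3⁺ whole; §4 by the cap between two declarations with `section Switch` and
its `variable` line replayed); file-level `open` lines replayed in every part; every declaration, docstring and `/-!
## § -/` comment exactly as in the lens files.]

(Sources: Hauser2010 §F; HauserPerlega2019 §2; CossartJannsenSaito2020 Ch. 8; Moh1987; Perlega2022.)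
-/

open MvPolynomial Finset
open Literature.AlgebraicGeometry.Resolution
open Literature.AlgebraicGeometry.Resolution.Hauser2010
open Literature.AlgebraicGeometry.Resolution.PointBlowup
open Literature.AlgebraicGeometry.Resolution.WeightedBlowup
open Summit.ResolutionOfSingularities.ResolutionOfSingularities.Theorems.TightDefectClasses
open Summit.ResolutionOfSingularities.ResolutionOfSingularities.Theorems.TightDefectStrongWalks
open Summit.ResolutionOfSingularities.ResolutionOfSingularities.Theorems.ItineraryCutClasses
open Summit.ResolutionOfSingularities.ResolutionOfSingularities.Theorems.BoundaryLedger
open Summit.ResolutionOfSingularities.ResolutionOfSingularities.Theorems.ProximityCut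
open Summit.ResolutionOfSingularities.ResolutionOfSingularities.Theorems.ConeCut
open Summit.ResolutionOfSingularities.ResolutionOfSingularities.Theorems.WallCutRun

namespace Summit.ResolutionOfSingularities.ResolutionOfSingularities.Theorems.LossExitCone

section Exit

variable {K : Type} [Field K] [DecidableEq K] {q : ℕ} {s₀ : State (Fin 3) K}

/-! ## §3 The chart-`j` exit law (X1) -/

/-- **X1 EXIT LAW — residual form (PROVED).**  At a plateau move `u` into the chart `j = W.j u` with boundary
`r_u = k·e_i + m·e_j` and the RUN SHAPE of the `u_j^m`-layer (`coeff_D F_u = coeff_D (c·u^{k e_i + m e_j + s e_l}·V)` for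
`D j = m`), the order is `s + k + m` and the residual form of the move is the pure power `C (c·V(0)) · u_l^s`. [new]
[folklore] -/
theorem exit_resForm (hroot : IsRoot q s₀) (W : ForcedWalk q s₀) (u : ℕ) {i l : Fin 3} {k m s : ℕ} {c : K}
    {V : MvPolynomial (Fin 3) K} (hij : i ≠ W.j u) (hlj : l ≠ W.j u)
    (hr : (W.st u).r = Finsupp.single i k + Finsupp.single (W.j u) m)
    (hsh : (W.st u).shade = (s : ℕ∞)) (hplat : (W.st (u + 1)).shade = (W.st u).shade) (hq : q < s + k + m)
    (hlayer : ∀ D : Fin 3 →₀ ℕ, D (W.j u) = m → coeff D (W.st u).F =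
      coeff D (monomial (Finsupp.single i k + Finsupp.single (W.j u) m + Finsupp.single l s) c * V)) :
    ordZero (W.st u).F = ((s + k + m : ℕ) : ℕ∞) ∧ resForm W u (s + k + m) = C (c * coeff 0 V) * X l ^ s := by
  classical
  obtain ⟨o, ho, -⟩ := walk_nat hroot W u
  obtain ⟨n, hn, hon⟩ := order_eq_shade_add_degree hroot W u ho
  have hns : n = s := by
    have h := hsh
    rw [hn] at h
    exact_mod_cast h
  subst hns
  have hrdeg : (W.st u).r.degree = k + m := by
    rw [hr, map_add, Finsupp.degree_single, Finsupp.degree_single]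
  have hos : o = n + k + m := by rw [hrdeg] at hon; omega
  subst hos
  refine ⟨ho, ?_⟩
  have hqo : q < n + k + m := by omega
  have hcone := (cone_of_plateau hroot W u ho hqo hplat hn).1
  have key : ∀ E : Fin 3 →₀ ℕ, E.degree = n →
      coeff E (resForm W u (n + k + m)) = if E = Finsupp.single l n then c * coeff 0 V else 0 := by
    intro E hE
    by_cases hEj : E (W.j u) = 0
    · have hrE : ((W.st u).r + E) (W.j u) = m := by
        rw [Finsupp.add_apply, hEj, add_zero, hr, Finsupp.add_apply, Finsupp.single_eq_of_ne hij.symm,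
          Finsupp.single_eq_same, zero_add]
      rw [coeff_resForm_top hroot W u ho hn hE hEj, hlayer _ hrE, coeff_monomial_mul', hr]
      by_cases hEl : E = Finsupp.single l n
      · rw [if_pos (by rw [hEl]), if_pos hEl, hEl, tsub_self]
      · rw [if_neg, if_neg hEl]
        intro hle
        apply hEl
        rw [add_le_add_iff_left] at hle
        exact (eq_of_le_of_degree_eq hle (by rw [hE, Finsupp.degree_single])).symm
    · rw [coeff_resForm_eq_zero W u _ hEj, if_neg]
      intro h
      apply hEj
      rw [h, Finsupp.single_eq_of_ne hlj.symm]
  ext E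
  rw [coeff_C_mul, coeff_X_pow]
  by_cases hE : E.degree = n
  · rw [key E hE]
    by_cases h : E = Finsupp.single l n
    · rw [if_pos h, if_pos h.symm, mul_one]
    · rw [if_neg h, if_neg (fun h' => h h'.symm), mul_zero]
  · rw [hcone.coeff_eq_zero hE, if_neg, mul_zero]
    intro h
    apply hE
    rw [← h, Finsupp.degree_single]

/-- **X1 EXIT LAW — dehomogenised initial form (PROVED):** under the hypotheses of `exit_resForm`,
`resLayer j (W.st u) o = C (c·V(0)) · (u_l − γ)^s` with `γ = W.b u l` (undo the translation of the move). [new] [folklore] -/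
theorem exit_resLayer (hroot : IsRoot q s₀) (W : ForcedWalk q s₀) (u : ℕ) {i l : Fin 3} {k m s : ℕ} {c : K}
    {V : MvPolynomial (Fin 3) K} (hij : i ≠ W.j u) (hlj : l ≠ W.j u)
    (hr : (W.st u).r = Finsupp.single i k + Finsupp.single (W.j u) m)
    (hsh : (W.st u).shade = (s : ℕ∞)) (hplat : (W.st (u + 1)).shade = (W.st u).shade) (hq : q < s + k + m)
    (hlayer : ∀ D : Fin 3 →₀ ℕ, D (W.j u) = m → coeff D (W.st u).F =
      coeff D (monomial (Finsupp.single i k + Finsupp.single (W.j u) m + Finsupp.single l s) c * V)) :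
    resLayer (W.j u) (W.st u) (s + k + m) = C (c * coeff 0 V) * (X l - C (W.b u l)) ^ s := by
  have h := (exit_resForm hroot W u hij hlj hr hsh hplat hq hlayer).2
  unfold resForm at h
  have h2 := congrArg (PointBlowup.translate (-W.b u)) h
  rw [translate_translate, neg_add_cancel, PointBlowup.translate_zero, translate_C_mul_X_pow] at h2
  rw [h2, Pi.neg_apply, C_neg, ← sub_eq_add_neg]

/-- **X1 EXIT LAW — initial form (PROVED):** under the hypotheses of `exit_resForm`, for every `|E| = s`,
`coeff_{r_u + E} F_u = c·V(0) · coeff_E (u_l − γ·u_j)^s` (`γ = W.b u l`): the initial form of `F_u` is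
`c·V(0) · u_i^k · u_j^m · (u_l − γ·u_j)^s` — the exit is a delayed proximity repeat onto the line `u_l = γ u_j` of the
exceptional plane, with NO extra `u_i`. [new] [folklore] -/
theorem exit_initialForm (hroot : IsRoot q s₀) (W : ForcedWalk q s₀) (u : ℕ) {i l : Fin 3} {k m s : ℕ} {c : K}
    {V : MvPolynomial (Fin 3) K} (hij : i ≠ W.j u) (hlj : l ≠ W.j u)
    (hr : (W.st u).r = Finsupp.single i k + Finsupp.single (W.j u) m)
    (hsh : (W.st u).shade = (s : ℕ∞)) (hplat : (W.st (u + 1)).shade = (W.st u).shade) (hq : q < s + k + m)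
    (hlayer : ∀ D : Fin 3 →₀ ℕ, D (W.j u) = m → coeff D (W.st u).F =
      coeff D (monomial (Finsupp.single i k + Finsupp.single (W.j u) m + Finsupp.single l s) c * V))
    (E : Fin 3 →₀ ℕ) (hE : E.degree = s) :
    coeff ((W.st u).r + E) (W.st u).F = (c * coeff 0 V) * coeff E ((X l - C (W.b u l) * X (W.j u)) ^ s) := by
  classical
  have ho := (exit_resForm hroot W u hij hlj hr hsh hplat hq hlayer).1
  have hrdeg : (W.st u).r.degree = k + m := by
    rw [hr, map_add, Finsupp.degree_single, Finsupp.degree_single]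
  rw [← coeff_resLayer (W.j u) (W.st u) (walk_r hroot W u) (s + k + m) E (by rw [hE, hrdeg, add_assoc]),
    exit_resLayer hroot W u hij hlj hr hsh hplat hq hlayer, coeff_C_mul, coeff_update_linear_pow hlj _ hE]

/-- **X1 EXIT LAW — the PREVIOUS residual form (PROVED):** if moreover the move `v = u − 1` before the exit is a plateau
move in the chart `i = W.j v` (order `o_v > q`; any translation), then already the residual form of the move `v` is the
pure power: `C (bUnit W v) · resForm W v o_v = C (c·V(0)) · (u_l − γ·u_j)^s`.  With `resForm_run_eq` (the residual form
is constant along the untranslated run) the residual form right after the proximity repeat that opened the run is that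
pure power too: an exit into the chart `j` is decided at the START of the run. [new] [folklore] -/
theorem exit_prev_resForm (hroot : IsRoot q s₀) (W : ForcedWalk q s₀) (v : ℕ) {l : Fin 3} {k m s : ℕ} {c : K}
    {V : MvPolynomial (Fin 3) K} (hij : W.j v ≠ W.j (v + 1)) (hlj : l ≠ W.j (v + 1)) (hli : l ≠ W.j v)
    (hr : (W.st (v + 1)).r = Finsupp.single (W.j v) k + Finsupp.single (W.j (v + 1)) m)
    {ov : ℕ} (hov : ordZero (W.st v).F = (ov : ℕ∞)) (hqov : q < ov)
    (hsh : (W.st (v + 1)).shade = (s : ℕ∞)) (hplat : (W.st (v + 1)).shade = (W.st v).shade)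
    (hplat' : (W.st (v + 2)).shade = (W.st (v + 1)).shade) (hq : q < s + k + m)
    (hlayer : ∀ D : Fin 3 →₀ ℕ, D (W.j (v + 1)) = m → coeff D (W.st (v + 1)).F =
      coeff D (monomial (Finsupp.single (W.j v) k + Finsupp.single (W.j (v + 1)) m + Finsupp.single l s) c * V)) :
    C (bUnit W v) * resForm W v ov = C (c * coeff 0 V) * (X l - C (W.b (v + 1) l) * X (W.j (v + 1))) ^ s := by
  classical
  have hshv : (W.st v).shade = (s : ℕ∞) := by rw [← hplat, hsh]
  have hcone := (cone_of_plateau hroot W v hov hqov hplat hshv).1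
  ext E
  rw [coeff_C_mul, coeff_C_mul]
  by_cases hdeg : E.degree = s
  · by_cases hEi : E (W.j v) = 0
    · rw [← restriction_of_plateau hroot W v hov hqov hplat hshv E hEi hdeg]
      exact exit_initialForm hroot W (v + 1) hij hlj hr hsh hplat' hq hlayer E hdeg
    · rw [coeff_resForm_eq_zero W v ov hEi, mul_zero,
        coeff_linear_pow_eq_zero _ _ _ (Or.inr ⟨W.j v, hij, hli.symm, hEi⟩), mul_zero]
  · rw [hcone.coeff_eq_zero hdeg, mul_zero, coeff_linear_pow_eq_zero _ _ _ (Or.inl hdeg), mul_zero]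

omit [DecidableEq K] in
/-- Translation of the linear form `u_l − γ·u_j`. [folklore] -/
theorem translate_linear (b : Fin 3 → K) (l j : Fin 3) (γ : K) :
    PointBlowup.translate b (X l - C γ * X j) = X l + C (b l) - C γ * (X j + C (b j)) := by
  unfold PointBlowup.translate
  rw [map_sub, map_mul, MvPolynomial.aeval_C, MvPolynomial.aeval_X, MvPolynomial.aeval_X, MvPolynomial.algebraMap_eq]

omit [DecidableEq K] in
/-- Translation of `C a · P^n`. [folklore] -/
theorem translate_C_mul_pow (b : Fin 3 → K) (a : K) (P : MvPolynomial (Fin 3) K) (n : ℕ) :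
    PointBlowup.translate b (C a * P ^ n) = C a * PointBlowup.translate b P ^ n := by
  unfold PointBlowup.translate
  rw [map_mul, map_pow, MvPolynomial.aeval_C, MvPolynomial.algebraMap_eq]

/-- **UNDOING THE TRANSLATION OF A PURE-POWER RESIDUAL FORM (PROVED):** if a unit multiple of the residual form of a move `w`
that stays on the wall `j` (`W.b w j = 0`) is the pure power `C a · (u_l − γ·u_j)^s`, then the dehomogenised initial form of
`F_w` itself is the pure power `C (e⁻¹a) · (u_l − β − γ·u_j)^s` with `β = W.b w l`: homogenising at the chart letter
`i = W.j w`, the initial form of `F_w` is `u^{r_w} · C(e⁻¹a) · (u_l − β·u_i − γ·u_j)^s` — an `s`-FOLD PLANE through the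
point, containing neither wall.  (Apply with `exit_prev_resForm` and `resForm_run_eq` to the proximity-repeat move that
opens the post-loss run: an exit of the run into the loss chart is DECIDED AT THE REPEAT, by the tangent cone of
`F_{t+1} / u_j^m` being an `s`-fold plane.) [new] [folklore] -/
theorem resLayer_eq_of_resForm_eq (W : ForcedWalk q s₀) (w : ℕ) {o s : ℕ} {e a γ : K} {j l : Fin 3} (he : e ≠ 0)
    (hbj : W.b w j = 0) (h : C e * resForm W w o = C a * (X l - C γ * X j) ^ s) :
    resLayer (W.j w) (W.st w) o = C (e⁻¹ * a) * (X l - C (W.b w l) - C γ * X j) ^ s := by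
  have h1 : resForm W w o = C (e⁻¹ * a) * (X l - C γ * X j) ^ s := by
    have := congrArg (fun P => C e⁻¹ * P) h
    rw [← mul_assoc, ← C_mul, inv_mul_cancel₀ he, C_1, one_mul, ← mul_assoc, ← C_mul] at this
    exact this
  unfold resForm at h1
  have h2 := congrArg (PointBlowup.translate (-W.b w)) h1
  rw [translate_translate, neg_add_cancel, PointBlowup.translate_zero, translate_C_mul_pow, translate_linear,
    Pi.neg_apply, Pi.neg_apply, hbj, neg_zero, C_0, add_zero, C_neg, ← sub_eq_add_neg] at h2
  exact h2

/-! ### §3⁺ After the exit: the new wall's layer (the episode restarts) -/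

/-- **AFTER THE EXIT MOVE — THE NEW WALL'S LAYER (PROVED):** under the hypotheses of `exit_resForm`, the layer of `F_{u+1}`
of `u_j`-degree exactly `s+k+m−q` (the mass of the wall created by the exit move) is `c·V(0) · (u_i + β)^k · u_l^s`,
`β = W.b u i`: for `E_j = 0`, `coeff_{E + (s+k+m−q)e_j} F_{u+1} = c·V(0) · coeff_E ((X_i + C β)^k · X_l^s)` — the translation
along `u_l` has been ABSORBED (`(u_l − γ + γ)^s = u_l^s`).  Tree tools only: `ConeCut.coeff_step_layer`, `initLayer_eq_mul`,
`exit_resLayer`. [new] [folklore] -/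
theorem exit_succ_layer (hroot : IsRoot q s₀) (W : ForcedWalk q s₀) (u : ℕ) {i l : Fin 3} {k m s : ℕ} {c : K}
    {V : MvPolynomial (Fin 3) K} (hij : i ≠ W.j u) (hlj : l ≠ W.j u)
    (hr : (W.st u).r = Finsupp.single i k + Finsupp.single (W.j u) m)
    (hsh : (W.st u).shade = (s : ℕ∞)) (hplat : (W.st (u + 1)).shade = (W.st u).shade) (hq : q < s + k + m)
    (hlayer : ∀ D : Fin 3 →₀ ℕ, D (W.j u) = m → coeff D (W.st u).F =
      coeff D (monomial (Finsupp.single i k + Finsupp.single (W.j u) m + Finsupp.single l s) c * V))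
    (E : Fin 3 →₀ ℕ) (hEj : E (W.j u) = 0) :
    coeff (E + Finsupp.single (W.j u) (s + k + m - q)) (W.st (u + 1)).F =
      (c * coeff 0 V) * coeff E ((X i + C (W.b u i)) ^ k * X l ^ s) := by
  classical
  have ho := (exit_resForm hroot W u hij hlj hr hsh hplat hq hlayer).1
  obtain ⟨o₁, ho₁, -, ho2⟩ := NoJump.order_lt_two_mul hroot W u
  have hoo : o₁ = s + k + m := by
    have h := ho₁.symm.trans ho
    exact_mod_cast h
  rw [hoo] at ho2
  have h := coeff_step_layer (W.j u) (W.b u) (W.onExc u) (W.st u) (o := s + k + m) (by omega) ho2 hEj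
  rw [← W.st_succ] at h
  have hupd : (W.st u).r.update (W.j u) 0 = Finsupp.single i k := by
    ext w
    rw [update_apply', hr, Finsupp.add_apply]
    by_cases hw : w = W.j u
    · rw [if_pos hw, hw, Finsupp.single_eq_of_ne hij.symm]
    · rw [if_neg hw, Finsupp.single_eq_of_ne hw, add_zero]
  rw [h, initLayer_eq_mul (W.j u) (W.st u) (walk_r hroot W u) (s + k + m), exit_resLayer hroot W u hij hlj hr hsh hplat
    hq hlayer, hupd, ← X_pow_eq_monomial]
  unfold PointBlowup.translate
  rw [map_mul, map_mul, map_pow, map_pow, map_sub, MvPolynomial.aeval_X, MvPolynomial.aeval_X, MvPolynomial.aeval_C,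
    MvPolynomial.aeval_C, MvPolynomial.algebraMap_eq, add_sub_cancel_right, mul_left_comm, coeff_C_mul]

/-- **THE BOUNDARY AFTER AN EXIT THAT KEEPS THE RUN WALL (PROVED, ledger):** if the exit move is untranslated along `u_i`
(`W.b u i = 0`), then `r_{u+1} = k·e_i + (s+k+m−q)·e_j`. [folklore] -/
theorem exit_succ_r (hroot : IsRoot q s₀) (W : ForcedWalk q s₀) (u : ℕ) {i l : Fin 3} {k m s : ℕ} {c : K}
    {V : MvPolynomial (Fin 3) K} (hij : i ≠ W.j u) (hlj : l ≠ W.j u)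
    (hr : (W.st u).r = Finsupp.single i k + Finsupp.single (W.j u) m)
    (hsh : (W.st u).shade = (s : ℕ∞)) (hplat : (W.st (u + 1)).shade = (W.st u).shade) (hq : q < s + k + m)
    (hlayer : ∀ D : Fin 3 →₀ ℕ, D (W.j u) = m → coeff D (W.st u).F =
      coeff D (monomial (Finsupp.single i k + Finsupp.single (W.j u) m + Finsupp.single l s) c * V))
    (hβ : W.b u i = 0) :
    (W.st (u + 1)).r = Finsupp.single i k + Finsupp.single (W.j u) (s + k + m - q) := by
  classical
  have ho := (exit_resForm hroot W u hij hlj hr hsh hplat hq hlayer).1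
  rw [r_succ_eq W u ho]
  congr 1
  ext w
  rw [kept_apply, hr, Finsupp.add_apply]
  by_cases hw : w = W.j u
  · rw [if_neg (fun h => h.1 hw), hw, Finsupp.single_eq_of_ne hij.symm]
  · by_cases hwi : w = i
    · rw [hwi, if_pos ⟨hij, hβ⟩, Finsupp.single_eq_same, Finsupp.single_eq_of_ne hij, add_zero]
    · rw [Finsupp.single_eq_of_ne hwi]
      split_ifs
      · rw [Finsupp.single_eq_of_ne hw, add_zero]
      · rfl

/-- **THE EPISODE RESTARTS (PROVED):** after an exit into the loss chart that KEEPS the run wall (`W.b u i = 0`), the layer of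
`F_{u+1}` of `u_j`-degree exactly `m₁ = s+k+m−q` = the new mass of the wall `j` is the SINGLE MONOMIAL
`c·V(0) · u_i^k u_j^{m₁} u_l^s` — the run-stage shape `hlayer` again, with `(k, m, V) ↦ (k, m₁, 1)`: the laws of the run
(`LossIsFatalLayer.run_step`, `run_letter_untranslated`, …) and this file's exit laws apply to the next moves
verbatim. [new] [folklore] -/
theorem exit_succ_layer_kept (hroot : IsRoot q s₀) (W : ForcedWalk q s₀) (u : ℕ) {i l : Fin 3} {k m s : ℕ} {c : K}
    {V : MvPolynomial (Fin 3) K} (hij : i ≠ W.j u) (hlj : l ≠ W.j u)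
    (hr : (W.st u).r = Finsupp.single i k + Finsupp.single (W.j u) m)
    (hsh : (W.st u).shade = (s : ℕ∞)) (hplat : (W.st (u + 1)).shade = (W.st u).shade) (hq : q < s + k + m)
    (hlayer : ∀ D : Fin 3 →₀ ℕ, D (W.j u) = m → coeff D (W.st u).F =
      coeff D (monomial (Finsupp.single i k + Finsupp.single (W.j u) m + Finsupp.single l s) c * V))
    (hβ : W.b u i = 0) (D : Fin 3 →₀ ℕ) (hD : D (W.j u) = s + k + m - q) :
    coeff D (W.st (u + 1)).F =
      coeff D (monomial (Finsupp.single i k + Finsupp.single (W.j u) (s + k + m - q) + Finsupp.single l s)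
        (c * coeff 0 V)) := by
  classical
  have hsplit : D = Finsupp.erase (W.j u) D + Finsupp.single (W.j u) (s + k + m - q) := by
    rw [← hD, Finsupp.erase_add_single]
  have hEj : (Finsupp.erase (W.j u) D) (W.j u) = 0 := Finsupp.erase_same
  rw [hsplit, exit_succ_layer hroot W u hij hlj hr hsh hplat hq hlayer _ hEj, hβ, C_0, add_zero, X_pow_eq_monomial,
    X_pow_eq_monomial, monomial_mul, one_mul, coeff_monomial, coeff_monomial]
  have hiff : Finsupp.single i k + Finsupp.single (W.j u) (s + k + m - q) + Finsupp.single l s =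
      Finsupp.erase (W.j u) D + Finsupp.single (W.j u) (s + k + m - q) ↔
      Finsupp.single i k + Finsupp.single l s = Finsupp.erase (W.j u) D := by
    rw [add_right_comm, add_left_inj]
  by_cases h : Finsupp.single i k + Finsupp.single l s = Finsupp.erase (W.j u) D
  · rw [if_pos h, if_pos (hiff.mpr h), mul_one]
  · rw [if_neg h, if_neg (fun h' => h (hiff.mp h')), mul_zero]

end Exit

end Summit.ResolutionOfSingularities.ResolutionOfSingularities.Theorems.LossExitCone
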